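import Literature.AnabelianGeometry.SemiGraphs.CosetCategoriesBridge
import Literature.AlgebraicGeometry.Frobenioids.PadicFrobenioidBaseGaloisSystemTransport
import HarnessLib

/-!
# The Galois pro-system on the SMALL base `CosetCat Π` (universe-correct for `PadicFrd.Datum`)

Mochizuki, *The geometry of Frobenioids II*, Kyushu J. Math. **62** (2008), §2, proof of Theorem 2.4 (ii),
p. 20 l.−5 – p. 21 l. 6 [cite: MochizukiFrdII2008, Thm 2.4 (ii) p.20] ("by varying the objects `Aᵢ` … `Ψ` induces
… `G₁ ⥲ G₂` … well-defined up to … elements of `G₂`"), on the small model `CosetCat Π` of `𝓑^temp(Π)⁰`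
(abc-iut-L1-t4 / L5-t2 `CosetCategories.lean`; objects = open subgroups `U` standing for `Π/U`).  The files
`PadicFrobenioidBaseGaloisSystem{,Independence,Transport}` (GAP row G-w5d188-1 (a)(b)(c)) work over
`ConnectedPart (BTemp Π)`, whose objects live in `Type (u+1)`; a `PadicFrd.Datum D p` needs `base : D ⥤ PadicFld.{u} p`
with `u` the universe of `Ob D` (note of record abc-iut-w5-d156, `PadicFieldwiseSaturatedGaloisBase.lean`), so the
W12 consumers index on `CosetCat Π : Type u`.  PROOF-ONLY companion (no `Prop`-valued definition):

* §1 DIRECT small model: `cosetSystem N hN : ℕ ⥤ (CosetCat Π)ᵒᵖ` (`k ↦ Π/N_k`, projections), `toAutCoset :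
  Π →* Aut (cosetSystem N hN)` (right translations), `toAutCosetMulEquiv : Π ≃* Aut (cosetSystem N hN)` for `Π`
  tempered and `N` cofinal (injective: "separated"; surjective: "complete"), `cosetSystem_cofinal`, `cosetSystem_torsor`
  (every term is Galois in the intrinsic sense);
* §2 BRIDGE: `cosetSystemCompIso : cosetSystem N hN ⋙ (CosetCat.toConnected hG).op ≅ galoisSystem hG N hN` (the small
  system IS the one of (a) under L1-t4's bridge `CosetCat.toConnected`), whence STRAIGHTENING on the small model
  (`exists_iso_cosetSystem`: every torsor + cofinal `c : ℕ ⥤ (CosetCat Π)ᵒᵖ` is `≅ cosetSystem N hN`, cofinal `N`) and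
  `exists_mulEquiv_aut_coset : Nonempty (Aut c ≃* Π)`.
-/

noncomputable section

namespace Literature.AlgebraicGeometry.Frobenioids

open CategoryTheory Opposite Topology Filter
open Literature.AnabelianGeometry.SemiGraphs

universe u

namespace BaseGaloisSystem

variable {G : Type u} [Group G] [TopologicalSpace G]

/-! ### §1 The small model, directly -/

/-- `Π/N` (`N` open normal) as an object of the small coset category. [cite: MochizukiFrdII2008, Ex 1.3 (i) p.11] -/
abbrev cQ (N : OpenNormalSubgroup G) : CosetCat G := ⟨N.toOpenSubgroup⟩

/-- The projection `Π/N → Π/M` (`N ≤ M`) in the coset category: `gN ↦ gM`. [cite: MochizukiFrdII2008, Ex 1.3 (i) p.11] -/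
def cproj {N M : OpenNormalSubgroup G} (h : N ≤ M) : cQ N ⟶ cQ M :=
  CosetCat.homMk ((1 : G) : (cQ M).carrier) fun u hu => (CosetCat.smul_one_eq_one_iff (cQ M) u).mpr (h hu)

/-- Right translation `xN ↦ x g N` in the coset category (`N` normal). [cite: MochizukiFrdII2008, Ex 1.3 (i) p.11] -/
def crightMul (N : OpenNormalSubgroup G) (g : G) : cQ N ⟶ cQ N :=
  CosetCat.homMk ((g : G) : (cQ N).carrier) fun u hu => by
    rw [MulAction.Quotient.smul_coe, smul_eq_mul, QuotientGroup.eq, mul_inv_rev]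
    exact N.isNormal'.conj_mem' u⁻¹ (inv_mem hu) g

/-- `pt (cproj h) = 1·M`. [cite: MochizukiFrdII2008, Ex 1.3 (i) p.11] -/
@[simp] theorem pt_cproj {N M : OpenNormalSubgroup G} (h : N ≤ M) :
    CosetCat.pt (cproj h) = ((1 : G) : (cQ M).carrier) := CosetCat.pt_homMk _ _

/-- `pt (crightMul N g) = gN`. [cite: MochizukiFrdII2008, Ex 1.3 (i) p.11] -/
@[simp] theorem pt_crightMul (N : OpenNormalSubgroup G) (g : G) :
    CosetCat.pt (crightMul N g) = ((g : G) : (cQ N).carrier) := CosetCat.pt_homMk _ _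

/-- `cproj` on a coset. [cite: MochizukiFrdII2008, Ex 1.3 (i) p.11] -/
theorem cproj_toFun_coe {N M : OpenNormalSubgroup G} (h : N ≤ M) (z : G) :
    CosetCat.Hom.toFun (cproj h) (z : (cQ N).carrier) = ((z : G) : (cQ M).carrier) := by
  rw [cproj, CosetCat.homMk_toFun_coe, MulAction.Quotient.smul_coe, smul_eq_mul, mul_one]

/-- `crightMul` on a coset. [cite: MochizukiFrdII2008, Ex 1.3 (i) p.11] -/
theorem crightMul_toFun_coe (N : OpenNormalSubgroup G) (g z : G) :
    CosetCat.Hom.toFun (crightMul N g) (z : (cQ N).carrier) = ((z * g : G) : (cQ N).carrier) := by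
  rw [crightMul, CosetCat.homMk_toFun_coe, MulAction.Quotient.smul_coe, smul_eq_mul]

/-- `cproj` along `N ≤ N` is the identity. [cite: MochizukiFrdII2008, Ex 1.3 (i) p.11] -/
theorem cproj_self (N : OpenNormalSubgroup G) (h : N ≤ N) : cproj h = 𝟙 (cQ N) :=
  CosetCat.hom_ext (by rw [pt_cproj, CosetCat.pt_id])

/-- `cproj` composes. [cite: MochizukiFrdII2008, Ex 1.3 (i) p.11] -/
theorem cproj_comp {N M L : OpenNormalSubgroup G} (h₁ : N ≤ M) (h₂ : M ≤ L) :
    cproj h₁ ≫ cproj h₂ = cproj (h₁.trans h₂) :=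
  CosetCat.hom_ext (by rw [CosetCat.pt_comp, pt_cproj, cproj_toFun_coe, pt_cproj])

/-- Right translations compose: `r_a ≫ r_b = r_{ab}`. [cite: MochizukiFrdII2008, Ex 1.3 (i) p.11] -/
theorem crightMul_comp (N : OpenNormalSubgroup G) (a b : G) :
    crightMul N a ≫ crightMul N b = crightMul N (a * b) :=
  CosetCat.hom_ext (by rw [CosetCat.pt_comp, pt_crightMul, crightMul_toFun_coe, pt_crightMul])

/-- Right translation by `1` is the identity. [cite: MochizukiFrdII2008, Ex 1.3 (i) p.11] -/
theorem crightMul_one (N : OpenNormalSubgroup G) : crightMul N 1 = 𝟙 (cQ N) :=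
  CosetCat.hom_ext (by rw [pt_crightMul, CosetCat.pt_id])

/-- Right translations commute with the projections. [cite: MochizukiFrdII2008, Ex 1.3 (i) p.11] -/
theorem crightMul_cproj {N M : OpenNormalSubgroup G} (h : N ≤ M) (g : G) :
    crightMul N g ≫ cproj h = cproj h ≫ crightMul M g :=
  CosetCat.hom_ext (by
    rw [CosetCat.pt_comp, CosetCat.pt_comp, pt_crightMul, cproj_toFun_coe, pt_cproj, crightMul_toFun_coe, one_mul])

/-- The right-translation isomorphism. [cite: MochizukiFrdII2008, Ex 1.3 (i) p.11] -/
def crightMulIso (N : OpenNormalSubgroup G) (g : G) : cQ N ≅ cQ N where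
  hom := crightMul N g
  inv := crightMul N g⁻¹
  hom_inv_id := by rw [crightMul_comp, mul_inv_cancel, crightMul_one]
  inv_hom_id := by rw [crightMul_comp, inv_mul_cancel, crightMul_one]

variable (N : ℕ → OpenNormalSubgroup G) (hN : Antitone N)

/-- **The Galois pro-system on the small model** `k ↦ Π/N_k`, transitions the projections.
[cite: MochizukiFrdII2008, Thm 2.4 (ii) p.20] -/
def cosetSystem : ℕ ⥤ (CosetCat G)ᵒᵖ where
  obj k := op (cQ (N k))
  map {j k} f := (cproj (hN f.le)).op
  map_id k := by
    change (cproj (hN le_rfl)).op = 𝟙 (op (cQ (N k)))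
    rw [cproj_self, op_id]
  map_comp {i j k} f g := by
    change (cproj (hN (f ≫ g).le)).op = (cproj (hN f.le)).op ≫ (cproj (hN g.le)).op
    rw [← op_comp, cproj_comp]

/-- Terms of the small Galois pro-system. [cite: MochizukiFrdII2008, Thm 2.4 (ii) p.20] -/
@[simp] theorem cosetSystem_obj (k : ℕ) : (cosetSystem N hN).obj k = op (cQ (N k)) := rfl

/-- Transitions of the small Galois pro-system. [cite: MochizukiFrdII2008, Thm 2.4 (ii) p.20] -/
theorem cosetSystem_map {j k : ℕ} (f : j ⟶ k) : (cosetSystem N hN).map f = (cproj (hN f.le)).op := rfl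

/-- **`Π →* Aut`** of the small Galois pro-system: compatible right translations.
[cite: MochizukiFrdII2008, Thm 2.4 (ii) p.21] -/
def toAutCoset : G →* Aut (cosetSystem N hN) where
  toFun g := NatIso.ofComponents (fun k => (crightMulIso (N k) g).op) (fun {j k} f => by
    change (cproj (hN f.le)).op ≫ (crightMul (N k) g).op = (crightMul (N j) g).op ≫ (cproj (hN f.le)).op
    rw [← op_comp, ← op_comp, crightMul_cproj])
  map_one' := by
    apply Iso.ext
    ext k
    change (crightMul (N k) 1).op = 𝟙 (op (cQ (N k)))
    rw [crightMul_one, op_id]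
  map_mul' a b := by
    apply Iso.ext
    ext k
    change (crightMul (N k) (a * b)).op = (crightMul (N k) b).op ≫ (crightMul (N k) a).op
    rw [← op_comp, crightMul_comp]

/-- Components of `toAutCoset g`. [cite: MochizukiFrdII2008, Thm 2.4 (ii) p.21] -/
@[simp] theorem toAutCoset_hom_app (g : G) (k : ℕ) :
    (toAutCoset N hN g).hom.app k = (crightMul (N k) g).op := rfl

/-- **Action formula**: the `k`-th component of `toAutCoset g` is `xN_k ↦ x g N_k`. [cite: MochizukiFrdII2008, Thm 2.4 (ii) p.21] -/
theorem toAutCoset_app_toFun (g : G) (k : ℕ) (x : G) :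
    CosetCat.Hom.toFun ((toAutCoset N hN g).hom.app k).unop (x : (cQ (N k)).carrier) =
      ((x * g : G) : (cQ (N k)).carrier) :=
  crightMul_toFun_coe (N k) g x

/-- **Cofinality** on the small model: every `Π/U` receives a morphism from some `Π/N_k`.
[cite: MochizukiFrdII2008, Thm 2.4 (ii) p.20] -/
theorem cosetSystem_cofinal (hNb : ∀ U ∈ 𝓝 (1 : G), ∃ k, (N k : Set G) ⊆ U) (X : CosetCat G) :
    ∃ k, Nonempty (((cosetSystem N hN).obj k).unop ⟶ X) := by
  obtain ⟨k, hk⟩ := hNb _ X.sg.mem_nhds_one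
  exact ⟨k, ⟨CosetCat.homMk ((1 : G) : X.carrier) fun u hu => (CosetCat.smul_one_eq_one_iff X u).mpr (hk hu)⟩⟩

omit hN in
/-- **Every `Π/N` is Galois (intrinsic torsor form)** in the coset category: two morphisms `S → Π/N` differ by a
right translation. [cite: MochizukiSemiAnbd2006, Rmk 3.1.3 p.34] -/
theorem cQ_torsor (M : OpenNormalSubgroup G) (S : CosetCat G) (ψ₁ ψ₂ : S ⟶ cQ M) :
    ∃ α : Aut (cQ M), ψ₁ = ψ₂ ≫ α.hom := by
  obtain ⟨a, ha⟩ := QuotientGroup.mk_surjective (CosetCat.pt ψ₁)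
  obtain ⟨b, hb⟩ := QuotientGroup.mk_surjective (CosetCat.pt ψ₂)
  refine ⟨crightMulIso M (b⁻¹ * a), CosetCat.hom_ext ?_⟩
  change CosetCat.pt ψ₁ = CosetCat.Hom.toFun (crightMul M (b⁻¹ * a)) (CosetCat.pt ψ₂)
  rw [← hb, crightMul_toFun_coe, mul_inv_cancel_left, ha]

/-- The terms of the small Galois pro-system are Galois (torsor form). [cite: MochizukiSemiAnbd2006, Rmk 3.1.3 p.34] -/
theorem cosetSystem_torsor (k : ℕ) (S : CosetCat G) (ψ₁ ψ₂ : S ⟶ ((cosetSystem N hN).obj k).unop) :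
    ∃ α : Aut ((cosetSystem N hN).obj k).unop, ψ₁ = ψ₂ ≫ α.hom :=
  cQ_torsor (N k) S ψ₁ ψ₂

variable (hG : IsTempered G)

include hG in
/-- `toAutCoset` is injective for a cofinal sequence ("separated"). [cite: MochizukiSemiAnbd2006, Def 3.1(i) p.33] -/
theorem toAutCoset_injective (hNb : ∀ U ∈ 𝓝 (1 : G), ∃ k, (N k : Set G) ⊆ U) :
    Function.Injective (toAutCoset N hN) := by
  rw [← MonoidHom.ker_eq_bot_iff, Subgroup.eq_bot_iff_forall]
  intro g hg
  rw [MonoidHom.mem_ker] at hg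
  have hmem : ∀ k, g ∈ N k := fun k => by
    have h := congrArg (fun α : Aut (cosetSystem N hN) => CosetCat.pt (α.hom.app k).unop) hg
    change CosetCat.pt (crightMul (N k) g) = CosetCat.pt (𝟙 (cQ (N k))) at h
    rw [pt_crightMul, CosetCat.pt_id, QuotientGroup.eq, mul_one, inv_mem_iff] at h
    exact h
  by_contra hne
  obtain ⟨M, hM⟩ := hG.separated g hne
  obtain ⟨k, hk⟩ := hNb _ M.toOpenSubgroup.mem_nhds_one
  exact hM (hk (hmem k))

omit [TopologicalSpace G] in
/-- Casting a coset equality to a larger subgroup (private plumbing). [folklore] -/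
private theorem coe_eq_coe_of_le' {K K' : Subgroup G} (hKK' : K ≤ K') {a b : G}
    (h : (a : G ⧸ K) = (b : G ⧸ K)) : (a : G ⧸ K') = (b : G ⧸ K') := by
  rw [QuotientGroup.eq] at h ⊢
  exact hKK' h

include hG in
/-- `toAutCoset` is surjective ("complete"). [cite: MochizukiSemiAnbd2006, Def 3.1(i) p.33] -/
theorem toAutCoset_surjective (hNb : ∀ U ∈ 𝓝 (1 : G), ∃ k, (N k : Set G) ⊆ U) :
    Function.Surjective (toAutCoset N hN) := by
  classical
  intro α
  have hgk : ∀ k, ∃ g : G, CosetCat.pt (α.hom.app k).unop = (g : (cQ (N k)).carrier) := fun k => by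
    obtain ⟨g, hg⟩ := QuotientGroup.mk_surjective (CosetCat.pt (α.hom.app k).unop)
    exact ⟨g, hg.symm⟩
  choose g hg using hgk
  -- the component IS right translation by `g_k` (a map out of `Π/N` is determined by its value at `N`)
  have hact : ∀ k, (α.hom.app k).unop = crightMul (N k) (g k) := fun k =>
    CosetCat.hom_ext ((hg k).trans (pt_crightMul (N k) (g k)).symm)
  -- compatibility along the projections
  have hcompat : ∀ j k, j ≤ k → (g k : G ⧸ (N j).toSubgroup) = (g j : G ⧸ (N j).toSubgroup) := by
    intro j k hjk
    have hle : N k ≤ N j := hN hjk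
    have h2 : crightMul (N k) (g k) ≫ cproj hle = cproj hle ≫ crightMul (N j) (g j) := by
      have h := congrArg Quiver.Hom.unop (α.hom.naturality (homOfLE hjk : j ⟶ k))
      rw [← hact k, ← hact j]
      exact h
    have h3 := congrArg CosetCat.pt h2
    rw [CosetCat.pt_comp, CosetCat.pt_comp, pt_crightMul, cproj_toFun_coe, pt_cproj, crightMul_toFun_coe,
      one_mul] at h3
    exact h3
  have hcompat' : ∀ i j, N j ≤ N i → (g j : G ⧸ (N i).toSubgroup) = (g i : G ⧸ (N i).toSubgroup) := by
    intro i j hji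
    rcases le_total i j with hij | hij
    · exact hcompat i j hij
    · have h := hcompat j i hij
      rw [QuotientGroup.eq] at h ⊢
      have h' : (g i)⁻¹ * g j ∈ (N i).toSubgroup := hji h
      simpa using (N i).toSubgroup.inv_mem h'
  have hkOf : ∀ M : OpenNormalSubgroup G, ∃ k, N k ≤ M := fun M => by
    obtain ⟨k, hk⟩ := hNb (M : Set G) M.toOpenSubgroup.mem_nhds_one
    exact ⟨k, SetLike.coe_subset_coe.mp hk⟩
  choose kOf hkOf using hkOf
  obtain ⟨y, hy⟩ := hG.complete (fun M => (g (kOf M) : G ⧸ M.toSubgroup)) (by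
    intro M M' hMM' y hy
    have h1 : (g (max (kOf M) (kOf M')) : G ⧸ M'.toSubgroup) = (g (kOf M') : G ⧸ M'.toSubgroup) :=
      coe_eq_coe_of_le' (hkOf M') (hcompat' (kOf M') _ (hN (le_max_right _ _)))
    have h2 : (g (max (kOf M) (kOf M')) : G ⧸ M'.toSubgroup) = (g (kOf M) : G ⧸ M'.toSubgroup) :=
      coe_eq_coe_of_le' ((hkOf M).trans hMM') (hcompat' (kOf M) _ (hN (le_max_left _ _)))
    rw [← h1, h2]
    exact coe_eq_coe_of_le' hMM' hy)
  have hyk : ∀ k, (g k : G ⧸ (N k).toSubgroup) = (y : G ⧸ (N k).toSubgroup) := fun k => by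
    rw [← hy (N k)]
    exact (hcompat' k (kOf (N k)) (hkOf (N k))).symm
  refine ⟨y, ?_⟩
  apply Iso.ext
  ext k : 2
  apply Quiver.Hom.unop_inj
  rw [hact k]
  exact CosetCat.hom_ext (by
    change CosetCat.pt (crightMul (N k) y) = CosetCat.pt (crightMul (N k) (g k))
    rw [pt_crightMul, pt_crightMul, hyk k])

/-- **`Π ≃* Aut` of the small Galois pro-system** (cofinal case). [cite: MochizukiSemiAnbd2006, Rmk 3.2.1 p.35] -/
def toAutCosetMulEquiv (hNb : ∀ U ∈ 𝓝 (1 : G), ∃ k, (N k : Set G) ⊆ U) : G ≃* Aut (cosetSystem N hN) :=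
  MulEquiv.ofBijective (toAutCoset N hN) ⟨toAutCoset_injective N hN hG hNb, toAutCoset_surjective N hN hG hNb⟩

/-- `toAutCosetMulEquiv` on elements. [cite: MochizukiSemiAnbd2006, Rmk 3.2.1 p.35] -/
@[simp] theorem toAutCosetMulEquiv_apply (hNb : ∀ U ∈ 𝓝 (1 : G), ∃ k, (N k : Set G) ⊆ U) (g : G) :
    toAutCosetMulEquiv N hN hG hNb g = toAutCoset N hN g := rfl

/-! ### §2 The bridge to `ConnectedPart (BTemp Π)` and straightening on the small model -/

variable [IsTopologicalGroup G]

/-- **The small system IS the system of (a) under the bridge** `CosetCat.toConnected` (componentwise the identity of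
`Π/N_k`; the transition maps agree pointwise). [cite: MochizukiFrdII2008, Ex 1.3 (i) p.11] -/
def cosetSystemCompIso : cosetSystem N hN ⋙ (CosetCat.toConnected hG).op ≅ galoisSystem hG N hN :=
  NatIso.ofComponents (fun _ => Iso.refl _) (fun {j k} f => by
    erw [Category.comp_id, Category.id_comp]
    apply Quiver.Hom.unop_inj
    apply ObjectProperty.hom_ext
    apply QuasiTemperoid.BTempConnected.hom_ext_apply
    intro x
    obtain ⟨z, rfl⟩ := QuotientGroup.mk_surjective x
    change CosetCat.Hom.toFun (cproj (hN f.le)) (z : (cQ (N k)).carrier) =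
      (BTemp.proj hG (hN f.le)).hom.hom (z : G ⧸ (N k).toSubgroup)
    rw [cproj_toFun_coe, BTemp.proj_apply])

/-- The actions correspond under the bridge: `toConnected (r_g) = rightMulC g`. [cite: MochizukiFrdII2008, Ex 1.3 (i) p.11] -/
theorem toConnected_map_crightMul (M : OpenNormalSubgroup G) (g : G) :
    (CosetCat.toConnected hG).map (crightMul M g) = rightMulC hG M g := by
  apply ObjectProperty.hom_ext
  apply QuasiTemperoid.BTempConnected.hom_ext_apply
  intro x
  obtain ⟨z, rfl⟩ := QuotientGroup.mk_surjective x
  change CosetCat.Hom.toFun (crightMul M g) (z : (cQ M).carrier) = (BTemp.rightMul hG M g).hom.hom (z : G ⧸ M.toSubgroup)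
  rw [crightMul_toFun_coe, BTemp.rightMul_apply]

include hG in
/-- **Straightening on the small model.**  Every `c : ℕ ⥤ (CosetCat Π)ᵒᵖ` with Galois (torsor) terms which is cofinal
is isomorphic to `cosetSystem N hN` for some cofinal antitone `N` — transported from (b)'s `exists_iso_galoisSystem`
along the fully faithful bridge. [cite: MochizukiFrdII2008, Thm 2.4 (ii) p.21] -/
theorem exists_iso_cosetSystem (c : ℕ ⥤ (CosetCat G)ᵒᵖ)
    (htor : ∀ (k : ℕ) (S : CosetCat G) (ψ₁ ψ₂ : S ⟶ (c.obj k).unop), ∃ α : Aut (c.obj k).unop, ψ₁ = ψ₂ ≫ α.hom)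
    (hcof : ∀ X : CosetCat G, ∃ k, Nonempty ((c.obj k).unop ⟶ X)) :
    ∃ (N : ℕ → OpenNormalSubgroup G) (hN : Antitone N),
      (∀ U ∈ 𝓝 (1 : G), ∃ k, (N k : Set G) ⊆ U) ∧ Nonempty (c ≅ cosetSystem N hN) := by
  let E := CosetCat.equivConnectedPart hG
  -- the image under the bridge is Galois + cofinal in `ConnectedPart (BTemp G)`
  obtain ⟨N, hN, hNb, ⟨ι⟩⟩ := exists_iso_galoisSystem hG (c ⋙ E.functor.op)
    (fun k => (isGaloisObj_obj_iff _).2 (torsor_functor_obj E (htor k))) (cofinal_comp_equivalence E c hcof)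
  refine ⟨N, hN, hNb, ⟨?_⟩⟩
  -- `c ⋙ E.op ≅ galoisSystem ≅ cosetSystem ⋙ E.op`, and whiskering by an equivalence reflects isomorphisms
  have ι' : c ⋙ E.functor.op ≅ cosetSystem N hN ⋙ E.functor.op := ι ≪≫ (cosetSystemCompIso N hN hG).symm
  exact (Equivalence.congrRight (E := ℕ) E.op).fullyFaithfulFunctor.preimageIso ι'

include hG in
/-- **`Aut c ≃* Π` for every Galois cofinal system on the small model.** [cite: MochizukiSemiAnbd2006, Rmk 3.2.1 p.35] -/
theorem exists_mulEquiv_aut_coset (c : ℕ ⥤ (CosetCat G)ᵒᵖ)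
    (htor : ∀ (k : ℕ) (S : CosetCat G) (ψ₁ ψ₂ : S ⟶ (c.obj k).unop), ∃ α : Aut (c.obj k).unop, ψ₁ = ψ₂ ≫ α.hom)
    (hcof : ∀ X : CosetCat G, ∃ k, Nonempty ((c.obj k).unop ⟶ X)) :
    Nonempty (Aut c ≃* G) := by
  obtain ⟨N, hN, hNb, ⟨ι⟩⟩ := exists_iso_cosetSystem hG c htor hcof
  exact ⟨ι.conjAut.trans (toAutCosetMulEquiv N hN hG hNb).symm⟩

end BaseGaloisSystem

end Literature.AlgebraicGeometry.Frobenioids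

end
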